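import Mathlib
import HarnessLib
import HarnessLib.Audit
import Summits.Langlands.Statement
import Summits.Langlands.Langlands.Theses.ParahoricFibre
import Summits.Langlands.Langlands.Theses.SmallRangeOrdinaryCarving
import Summits.Langlands.Langlands.Theorems.OrdinaryLocusCarving
import Literature.NumberTheory.GaloisRepresentations.OrdinaryRegular
import Literature.NumberTheory.GaloisRepresentations.LocalClassFieldTheory
import Literature.NumberTheory.GaloisRepresentations.LocalArtinMapPinned
import Literature.NumberTheory.GaloisRepresentations.ResidualGaloisRep
import Literature.NumberTheory.GaloisRepresentations.WeilDeligneOfGaloisExistence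
import Literature.NumberTheory.GaloisRepresentations.GrothendieckDeligneWeilDeligneExistenceHolds

/-!
# `SmallRangeOrdinaryCarving` — lens-6 (barrier-complement carving), decomp-langlands g25, RESIDUAL MODE / BLOCKER FIRST (D-0179)

TARGET (used BY NAME, never restated): the rank-4 OPEN crux and DECLARED RESIDUAL of the LIVE route `ParahoricFibre`,
`Summit.Langlands.Langlands.Theses.ParahoricFibre.SmallRangeGenericMonodromy` (stmt-Langlands-18195; tree text 1927 ch, sha12 baf988ef7939):
for `K` CM, `π` regular algebraic cuspidal on `GL_n(𝔸_K)`, a prime `p`, `ι : ℚ̄_p ≃ ℂ` and a SEMISIMPLE `ρ : Γ_K → GL_n(ℚ̄_p)`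
carrying the Satake-predicted Frobenius characteristic polynomials of `π` cofinitely, if the datum `(p, ρ)` is NOT in the host's
PATCHING RANGE (`p > n²`, `p ∤ disc K`, `π` unramified above `p`, an integral frame with reduction `⊇ SL_n(𝔽_p)`, a decomposed
generic prime), then at every `v ∤ p` some Weil–Deligne representation attached to `ρ|_{W_{K_v}}` (Grothendieck–Deligne) is GENERIC
(the inline clause is literally the body of `WeilDeligneRep.IsGeneric`, Allen 2016 Def. 1.1.2).  One refining child exists already:
lens-3-g18's `MonodromyRankLadder` (route-Langlands-MonodromyRankLadder), which grades T's CONCLUSION by the rank of `N`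
(X₁ conductor rung, X₂ deeper rungs, mod two proved algebra supports).  THIS node is its OR-SIBLING with a TRANSVERSE dial: it
restricts T's POPULATION and keeps T's conclusion verbatim (insertion anchors in disjoint text regions; the 2 × 2 joint refinement
`T ↔ (X₁ ∧ X₂) ↔ ((ORDBOX ∧ OFFBOX)-versions)` is formal).

THE DIAL = the «MATSUMOTO ORDINARY BOX» `MB(K,n,p,ρ)` — the exact hypothesis set of the one printed theorem that proves
Frobenius-semisimple local–global compatibility at `v ∤ p` for `GL_n` over a CM field at a PRESCRIBED prime `p` OUTSIDE the host's
patching range, K. Matsumoto, arXiv:2312.01551, Thm. 5.22 [corpus: paper:arxiv-2312.01551 p.76 L62 – p.77 L9] («`l > n²`, `ζ_l ∉ F`,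
`r : G_F → GL_n(ℚ̄_l)` an ALGEBRAIC `l`-adic representation with (1) `r̄` FULLY DECOMPOSED GENERIC (Def. 5.9, p.68 L40 – p.69 L2), (2)
`r̄|_{G_{F(ζ_l)}}` absolutely irreducible, (4) `r|_{G_{F_v}}` ORDINARY for all `v ∣ l` ⇒ there are a finite CM Galois `F'/F` and an
`ι`-ordinary cohomological cuspidal `Π` of `GL_n(𝔸_{F'})` with `r|_{G_{F'}} ≅ r_ι(Π)` AND `ιWD(r_ι(Π)|_{G_{F'_v}})^{F-ss} ≅ rec(Π_v ⊗ |det|^{(1-n)/2})`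
for all `v ∤ l`»).  Its hypotheses are GALOIS-SIDE, and it needs NEITHER `p ∤ disc K`, NOR `π` unramified above `p`, NOR residual
image `⊇ SL_n(𝔽_p)` — so its box meets T's off-range population in a NON-EMPTY print sector (ordinary `ρ` at a prime `p` ramified in
`K`, or with `π` Iwahori-ramified above `p`, or with small but adequate residual image).  Typed over accepted declarations only:
  `MB(K,n,p,ρ)` := `n ^ 2 < p`
    `∧ (¬ ∃ ζ : K, IsPrimitiveRoot ζ p)`                                   — `ζ_p ∉ K` (Mathlib `IsPrimitiveRoot`)
    `∧ (ρ.restrictField (CyclotomicField p K)).IsResiduallyAbsIrreducible` — hypothesis (2) (vocabulary byte-shared with the born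
        `CoreAdequacySplit.AdequateImageLifting`; `FramedGaloisRep.IsResiduallyAbsIrreducible`, ResidualGaloisRep.lean :367)
    `∧ FDG` := `(∃ l : ℕ, l.Prime ∧ l ≠ p ∧ ¬ (p ∣ (l - 1)) ∧ ¬ ((l : ℤ) ∣ NumberField.discr K) ∧ ∀ w : HeightOneSpectrum (𝓞 K), ((l : ℕ) : 𝓞 K) ∈ w.asIdeal → w.residueCard = l ∧ ρ.IsUnramifiedAt w ∧ ∃ a : Fin n → PadicAlgCl p, ρ.HasFrobCharpolyAt w (∏ i, (X - C (a i))) ∧ ∀ i j : Fin n, i ≠ j → ‖a i - (l : PadicAlgCl p) * a j‖ = 1)`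
        — Def. 5.9 typed LITERALLY: `l ≠ p` prime, `l ∤ disc K` and residue degree one above `l` (= `l` splits completely), `ρ` unramified
        above `l`, Frobenius roots `a` with `ᾱ_i ≠ l·ᾱ_j` for `i ≠ j` (`‖a_i − l a_j‖ = 1`) and for `i = j` (`⟺ p ∤ l − 1`)
    `∧ ORD` := `(∀ w : HeightOneSpectrum (𝓞 K), ((p : ℕ) : 𝓞 K) ∈ w.asIdeal → ∀ art : LocalArtinData (w.adicCompletion K), art.IsCanonical → ρ.IsOrdinaryRegularAt w art)`
        — hypothesis (4): `FramedGaloisRep.IsOrdinaryRegularAt` (Qian 2022 Def. 1.2, OrdinaryRegular.lean :460) = Matsumoto Def. 3.32 / Lemma 3.31 (1)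
        [p.30 L64 – p.31 L4: an increasing filtration with rank-one graded pieces `χ_i` equal on an open subgroup of `𝒪_K^×` to
        `u ↦ ∏_τ τ(u)^{−λ_{τ,n−i+1} − i + 1}`, `λ` dominant]; the same text as the dial of the born sibling `OrdinaryLocusCarving` (g24) on crux 18194.
The dial is WELL POSED (kernel, section `Dial`): `matsumotoBox_iff` (`Iff.rfl` against the structured form), canonical Artin data exist
(`canonicalArtinData_exists`, from the tree's PROVED `exists_isLocalArtinMap_holds`), any two give the same ordinarity predicate
(`isOrdinaryRegularAt_canonical_congr`), so ORD's `∀ art` form equals its `∃ art` form (`ord_forall_iff_exists`).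

CELLS (each = T VERBATIM with ONE hypothesis inserted after T's own off-range binder `¬ (…) →` and before `∀ v`; texts.json sha12:
ORDBOX 487e1ce2a27e, OFFBOX 582c285454a4; target baf988ef7939):
* `OrdinaryBoxGenericMonodromy` — crux 2 · WEAKER (`ordbox_of_target`) · PRINT MODULO TYPED JUNCTIONS, tagged ATTACKABLE:
  J0 (`ρ` algebraic: de Rham at `w ∣ p` from ORD itself, Lemma 3.31 (1)⇒(2) [p.31 L5–10]; unramified a.e. from the Satake clause) →
  JM = Matsumoto Thm. 5.22 (potential `ι`-ordinary automorphy of `ρ` over a CM `F'` WITH F-ss local–global compatibility upstairs) →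
  J4′ (F-ss compatibility + `Π_u` generic ⇒ `WD(ρ|_{G_{F'_u}})` generic: AHTW arXiv:2607.11763 Prop. 6.0.5 = the tree's discharged fact
  `AHTW2026_prop_6_0_5_generic_conj`, Frobenius-semisimplification invariance = the sibling's proved support
  `MonodromyRankLadder.FrobSemisimplificationGeneric`, Grothendieck–Deligne uniqueness `IsWeilDeligneOfLadic.isEquivalent` PROVED) →
  JD = DESCENT OF GENERICITY along `W_{F'_u} ⊂ W_{K_v}` (pure local algebra: a non-zero morphism `(r,N) → (r(1),N)` over `W_{K_v}` restricts
  to one over the open subgroup `W_{F'_u}` because `q_v^{deg_v w} = q_u^{deg_u w}`; so generic upstairs ⇒ generic downstairs).  NO `ι`-ordinarity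
  junction is needed (the dial is Galois-side and so is Thm. 5.22's hypothesis (4)); NO Chebotarev junction (Def. 5.9 and (2), (3) are typed
  literally).  BC3 line (section `OrdinaryBoxLine`, kernel-checked composition `ordbox_of_line`): stub P `PotentialOrdinaryGenericity`
  (= JM ∘ J4′ in T's currency, sha12 983fe1387e81) + stub D `GenericityDescends` (= JD, sha12 d59a0ee9dc6c) ⇒ ORDBOX, through the
  existence of a place `u ∣ v` of `F'` (Mathlib going-up `Ideal.exists_ideal_over_maximal_of_isIntegral`) — a REAL composition, not a rename.
  Outside `FamilyWitnessConsecutiveWeights` BY CONSTRUCTION (ordinary points lie on Hida families with classical points in every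
  sufficiently regular weight — exactly what Matsumoto's Thm. 4.56 / ACC+23 §6 use for Ihara avoidance with weight change), outside
  `ResiduallyReducibleLocus` / `ResiduallyReducibleBarrier` by MB(2), `MonodromyNotClosedUnderPadicLimits` not entered (no `N` is read
  off a limit: potential automorphy + level raising at a fixed classical `Π`).
* `OffOrdinaryBoxGenericMonodromy` — residual 3 · WEAKER (`offbox_of_target`) · DECLARED RESIDUAL · IDEA-NEEDED│BARRIER: the off-range data OUTSIDE the
  box — (i) `ρ` NOT ordinary at some `w ∣ p` (head-on `FamilyWitnessConsecutiveWeights` + `PatchingLocalComponentBarrier`: no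
  weight-changing family at a fixed non-ordinary `p`; print decides only `n = 2 ∧` weight 0 in range, Allen–Newton Thm. 4.1, or a
  positive-density set of `l`, Matsumoto Thms. 1.3/1.5), (ii) `r̄|_{K(ζ_p)}` absolutely reducible (`ResiduallyReducibleLocus`; ANT
  residually-reducible ordinary lifting needs extra hypotheses), (iii) `p ≤ n²` or `ζ_p ∈ K` or no fully decomposed generic prime
  (e.g. `ζ_p` in the Galois closure of `K`).  BC3 line (section `OffBoxSeam`): the PARENT's registered skeleton
  `Cruxes/SmallRangeGenericMonodromy/Lines/birth.lean` re-homed — stub S1∣OFFBOX (genericity prime switch, sha12 451251c2ee42) and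
  stub S2∣OFFBOX (small-monodromy genericity, sha12 772a00b71e36), `¬MB` threaded after `ρ`'s Satake clause, with the host's items
  `ParahoricOccurrence`, `OccurrenceToGeneric` BY NAME; composition `offbox_of_seam` = the parent's dichotomy by `π`, kernel-checked.

DEGENERATE CORNER (recorded, not split): `n ≤ 1` — both cells hold there outright on paper (`N = 0`, rank-one Weil–Deligne
representations are generic; class field theory currency), a corner of T itself, not a witness of any lever.

KERNEL (EXACT mod NOTHING): `smallRange_iff_cells : T ↔ ORDBOX ∧ OFFBOX` (pointwise excluded middle on `MB(K,n,p,ρ)`),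
`smallRange_of_cells : ORDBOX → OFFBOX → T` BY NAME (= the born child route's `closes`), `ordbox_of_target`, `offbox_of_target` (cells WEAKER),
`root_of_cells : ORDBOX → OFFBOX → ParahoricOccurrence → OccurrenceToGeneric → MonodromyToLanglands → ParahoricFibre.Assembly → Langlands`
through the host's landed `ParahoricFibre.closes`.  Axioms of every theorem here: `propext`, `Classical.choice`, `Quot.sound`.  No `sorry`.

CENSUS TWIN (census-1 g26): the route is BORN (81st cell route, route-Langlands-SmallRangeOrdinaryCarving rev 0 @c9c7f729e67b = the lens-6-g25 node
HOME/nodes/lens-6-g25-SmallRangeOrdinaryCarving.lean, crit-1 CLEARED row 292; items ORDBOX stmt-Langlands-27894 · OFFBOX 27895 · Assembly 27896 CLOSED by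
`Theorems/SmallRangeOrdinaryCarvingAssembly.lean`), so the two cells and the Assembly are NOT re-declared here: every kernel refers to the BORN ROUTE
DECLS BY NAME (`open Summit.Langlands.Langlands.Theses.SmallRangeOrdinaryCarving (OrdinaryBoxGenericMonodromy OffOrdinaryBoxGenericMonodromy)`; the writer
rendered the kit texts byte-identically — census check: cell bodies 2523/2525 ch and Assembly 140 ch IDENTICAL — so every proof goes through unchanged);
the node's `closes_child`/`closes` are renamed `smallRange_of_cells`/`root_of_cells` (a helper may not declare `closes`), the duplicate `assembly_holds` and
the `#print axioms` tails are dropped; the two local-class-field-theory certificates `canonicalArtinData_exists` /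
`isOrdinaryRegularAt_canonical_congr` are imported from the sibling twin `Theorems/OrdinaryLocusCarving.lean` (p810928) instead of restated (gate dedup).  Filed `--supports stmt-Langlands-18195 --as helper` (T = the parent crux this carve refines).
-/

set_option linter.dupNamespace false
set_option linter.unusedVariables false

namespace Summit.Langlands.Langlands.Theorems.SmallRangeOrdinaryCarving

open Summit.Langlands.Langlands.Theses.SmallRangeOrdinaryCarving (OrdinaryBoxGenericMonodromy OffOrdinaryBoxGenericMonodromy)

open scoped BigOperators Topology Manifold Classical MeasureTheory ProbabilityTheory Matrix InnerProductSpace ComplexConjugate ContinuousMap NumberField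
open Filter Set Function TopologicalSpace MeasureTheory

/-! ## The two cells `OrdinaryBoxGenericMonodromy` (stmt-Langlands-27894) and `OffOrdinaryBoxGenericMonodromy` (stmt-Langlands-27895) and the
`Assembly` (stmt-Langlands-27896) are the BORN ROUTE's decls (`Summits.Langlands.Langlands.Theses.SmallRangeOrdinaryCarving`), used by name. -/

/-! ## The dial is well posed (kernel certificates) -/

section Dial

open IsDedekindDomain Polynomial Literature.NumberTheory.Automorphic Literature.NumberTheory.GaloisRepresentations

variable (K : Type) [Field K] [NumberField K] (n p : ℕ) [Fact p.Prime]

/-- ORD(K,p,ρ): at every place `w ∣ p`, `ρ|_{Γ_{K_w}}` is ordinary of some dominant labelled weight (`IsOrdinaryRegularAt`,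
Qian Def. 1.2 = Matsumoto Def. 3.32) relative to every CANONICAL local Artin datum — the g24 dial, verbatim. [folklore] -/
def OrdinaryAtP (ρ : FramedGaloisRep K (PadicAlgCl p) n) : Prop :=
  ∀ w : HeightOneSpectrum (𝓞 K), ((p : ℕ) : 𝓞 K) ∈ w.asIdeal →
    ∀ art : LocalArtinData (w.adicCompletion K), art.IsCanonical → ρ.IsOrdinaryRegularAt w art

/-- FDG(K,n,p,ρ): a FULLY DECOMPOSED GENERIC prime `l ≠ p` for `ρ` (Matsumoto Def. 5.9, typed literally). [cite: Matsumoto2023LGC, Def. 5.9] -/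
def FullyDecomposedGenericPrime (ρ : FramedGaloisRep K (PadicAlgCl p) n) : Prop :=
  (∃ l : ℕ, l.Prime ∧ l ≠ p ∧ ¬ (p ∣ (l - 1)) ∧ ¬ ((l : ℤ) ∣ NumberField.discr K) ∧ ∀ w : HeightOneSpectrum (𝓞 K), ((l : ℕ) : 𝓞 K) ∈ w.asIdeal → w.residueCard = l ∧ ρ.IsUnramifiedAt w ∧ ∃ a : Fin n → PadicAlgCl p, ρ.HasFrobCharpolyAt w (∏ i, (X - C (a i))) ∧ ∀ i j : Fin n, i ≠ j → ‖a i - (l : PadicAlgCl p) * a j‖ = 1)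

/-- The «Matsumoto ordinary box» `MB(K,n,p,ρ)` — the inserted hypothesis, as a named predicate (body = the inserted text). [cite: Matsumoto2023LGC, Thm. 5.22] -/
def MatsumotoBox (ρ : FramedGaloisRep K (PadicAlgCl p) n) : Prop :=
  (n ^ 2 < p ∧ (¬ ∃ ζ : K, IsPrimitiveRoot ζ p) ∧ (ρ.restrictField (CyclotomicField p K)).IsResiduallyAbsIrreducible ∧ (∃ l : ℕ, l.Prime ∧ l ≠ p ∧ ¬ (p ∣ (l - 1)) ∧ ¬ ((l : ℤ) ∣ NumberField.discr K) ∧ ∀ w : HeightOneSpectrum (𝓞 K), ((l : ℕ) : 𝓞 K) ∈ w.asIdeal → w.residueCard = l ∧ ρ.IsUnramifiedAt w ∧ ∃ a : Fin n → PadicAlgCl p, ρ.HasFrobCharpolyAt w (∏ i, (X - C (a i))) ∧ ∀ i j : Fin n, i ≠ j → ‖a i - (l : PadicAlgCl p) * a j‖ = 1) ∧ (∀ w : HeightOneSpectrum (𝓞 K), ((p : ℕ) : 𝓞 K) ∈ w.asIdeal → ∀ art : LocalArtinData (w.adicCompletion K), art.IsCanonical → ρ.IsOrdinaryRegularAt w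 art))

/-- `MB` IS the structured conjunction `n² < p ∧ ζ_p ∉ K ∧ (2) ∧ FDG ∧ ORD` (syntactic check, `Iff.rfl`). [folklore] -/
theorem matsumotoBox_iff (ρ : FramedGaloisRep K (PadicAlgCl p) n) :
    MatsumotoBox K n p ρ ↔ (n ^ 2 < p ∧ (¬ ∃ ζ : K, IsPrimitiveRoot ζ p) ∧ (ρ.restrictField (CyclotomicField p K)).IsResiduallyAbsIrreducible ∧
      FullyDecomposedGenericPrime K n p ρ ∧ OrdinaryAtP K n p ρ) := Iff.rfl

variable {K n p} in
/-- the box forces the small range `n² < p`. [folklore] -/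
theorem matsumotoBox_lt {ρ : FramedGaloisRep K (PadicAlgCl p) n} (h : MatsumotoBox K n p ρ) : n ^ 2 < p := h.1

variable {K n p} in
/-- the box forces ordinarity above `p` (so ORDBOX sits inside the sibling g24 cell's ordinary locus). [folklore] -/
theorem matsumotoBox_ordinary {ρ : FramedGaloisRep K (PadicAlgCl p) n} (h : MatsumotoBox K n p ρ) : OrdinaryAtP K n p ρ := h.2.2.2.2

variable {K n p} in
/-- the box forces absolute irreducibility of `r̄|K(ζ_p)` (so ORDBOX sits outside the residually-reducible locus). [folklore] -/
theorem matsumotoBox_absIrreducible {ρ : FramedGaloisRep K (PadicAlgCl p) n} (h : MatsumotoBox K n p ρ) :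
    (ρ.restrictField (CyclotomicField p K)).IsResiduallyAbsIrreducible := h.2.2.1

/- `canonicalArtinData_exists` and `isOrdinaryRegularAt_canonical_congr` are NOT restated (gate dedup.landed): they are the landed declarations of the
   sibling census twin `Summits.Langlands.Langlands.Theorems.OrdinaryLocusCarving` (p810928), imported and used by name below. -/

/-- **ORD's `∀ canonical art` = `∃ canonical art`**: the dial does not depend on the quantifier over Artin data. [folklore] -/
theorem ord_forall_iff_exists (ρ : FramedGaloisRep K (PadicAlgCl p) n) :
    OrdinaryAtP K n p ρ ↔ ∀ w : HeightOneSpectrum (𝓞 K), ((p : ℕ) : 𝓞 K) ∈ w.asIdeal →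
      ∃ art : LocalArtinData (w.adicCompletion K), art.IsCanonical ∧ ρ.IsOrdinaryRegularAt w art := by
  refine forall_congr' fun w => forall_congr' fun _ => ?_
  constructor
  · intro h
    obtain ⟨art, hart⟩ := Summit.Langlands.Langlands.Theorems.OrdinaryLocusCarving.canonicalArtinData_exists K w
    exact ⟨art, hart, h art hart⟩
  · rintro ⟨art, hart, hord⟩ art' hart'
    exact (Summit.Langlands.Langlands.Theorems.OrdinaryLocusCarving.isOrdinaryRegularAt_canonical_congr w hart' hart ρ).2 hord

/-- **ORD does not see the frame** (accepted `FramedGaloisRep.isOrdinaryRegularAt_conj_iff`). [folklore] -/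
theorem ord_conj_iff (P : GL (Fin n) (PadicAlgCl p)) (ρ : FramedGaloisRep K (PadicAlgCl p) n) :
    OrdinaryAtP K n p (ρ.conj P) ↔ OrdinaryAtP K n p ρ := by
  simp only [OrdinaryAtP, FramedGaloisRep.isOrdinaryRegularAt_conj_iff]

end Dial

/-! ## Kernel: EXACT mod NOTHING -/

/-- **T ⟺ ORDBOX ∧ OFFBOX** — pointwise excluded middle on `MB(K,n,p,ρ)`. [folklore] -/
theorem smallRange_iff_cells :
    Summit.Langlands.Langlands.Theses.ParahoricFibre.SmallRangeGenericMonodromy ↔ (OrdinaryBoxGenericMonodromy ∧ OffOrdinaryBoxGenericMonodromy) := by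
  constructor
  · intro h
    exact ⟨fun K _ _ hK n hcpt π hπ p _ ι ρ hss hsat hoff _ => h K hK n hcpt π hπ p ι ρ hss hsat hoff,
      fun K _ _ hK n hcpt π hπ p _ ι ρ hss hsat hoff _ => h K hK n hcpt π hπ p ι ρ hss hsat hoff⟩
  · rintro ⟨hB, hO⟩ K _ _ hK n hcpt π hπ p _ ι ρ hss hsat hoff
    exact Classical.byCases (fun hMB => hB K hK n hcpt π hπ p ι ρ hss hsat hoff hMB)
      (fun hMB => hO K hK n hcpt π hπ p ι ρ hss hsat hoff hMB)

/-- **V-R glue**: the cells decide the PARENT decl by name. [folklore] -/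
theorem smallRange_of_cells (hB : OrdinaryBoxGenericMonodromy) (hO : OffOrdinaryBoxGenericMonodromy) : Summit.Langlands.Langlands.Theses.ParahoricFibre.SmallRangeGenericMonodromy :=
  smallRange_iff_cells.2 ⟨hB, hO⟩

/-- cell ORDBOX is WEAKER than T. [folklore] -/
theorem ordbox_of_target (h : Summit.Langlands.Langlands.Theses.ParahoricFibre.SmallRangeGenericMonodromy) : OrdinaryBoxGenericMonodromy := (smallRange_iff_cells.1 h).1
/-- cell OFFBOX is WEAKER than T. [folklore] -/
theorem offbox_of_target (h : Summit.Langlands.Langlands.Theses.ParahoricFibre.SmallRangeGenericMonodromy) : OffOrdinaryBoxGenericMonodromy := (smallRange_iff_cells.1 h).2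

/-- the inserted hypothesis of ORDBOX IS `MatsumotoBox` (definitional: the cell restricted along the named predicate). [folklore] -/
theorem ordbox_iff_box : OrdinaryBoxGenericMonodromy ↔
    (open IsDedekindDomain NumberField Polynomial Filter Literature.NumberTheory.Automorphic Literature.NumberTheory.GaloisRepresentations in
    ∀ (K : Type) [Field K] [NumberField K], NumberField.IsCMField K → ∀ (n : ℕ) (hcpt : isCompact_glFiniteIntegralLevel n K) (π : CuspidalAutomorphicRepData n K hcpt), π.1.IsRegularAlgebraic → ∀ (p : ℕ) [Fact p.Prime] (ι : PadicAlgCl p ≃+* ℂ) (ρ : FramedGaloisRep K (PadicAlgCl p) n), ρ.toGaloisRep.IsSemisimple → (∀ᶠ v : HeightOneSpectrum (𝓞 K) in cofinite, ∀ α : Multiset ℂ, π.1.HasSatakeParamAt v α → ρ.IsUnramifiedAt v ∧ ρ.HasFrobCharpolyAt v (arithFrobPolyOfSatake ι v.residueCard n α)) → ¬ (n ^ 2 < p ∧ ¬ ((p : ℤ) ∣ NumberField.discr K) ∧ (∀ w : HeightOneSpectrum (𝓞 K), ((p : ℕ) : 𝓞 K) ∈ w.asIdeal → π.1.IsUnramifiedAt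 w) ∧ (∃ g : GL (Fin n) (PadicAlgCl p), (∀ (σ : Field.absoluteGaloisGroup K) (i j : Fin n), ‖((g * ρ σ * g⁻¹ : GL (Fin n) (PadicAlgCl p)) : Matrix (Fin n) (Fin n) (PadicAlgCl p)) i j‖ ≤ 1) ∧ (∀ M : Matrix (Fin n) (Fin n) ℤ, M.det = 1 → ∃ σ : Field.absoluteGaloisGroup K, ∀ i j : Fin n, ‖((g * ρ σ * g⁻¹ : GL (Fin n) (PadicAlgCl p)) : Matrix (Fin n) (Fin n) (PadicAlgCl p)) i j - ((M i j : ℤ) : PadicAlgCl p)‖ < 1)) ∧ (∃ l : ℕ, l.Prime ∧ l ≠ p ∧ ∀ w : HeightOneSpectrum (𝓞 K), ((l : ℕ) : 𝓞 K) ∈ w.asIdeal → w.residueCard = l ∧ ρ.IsUnramifiedAt w ∧ ∃ a : Fin n → PadicAlgCl p, ρ.HasFrobCharpolyAt w (∏ i, (X - C (a i))) ∧ ∀ i j : Fin n, i ≠ j → ‖a i - a j‖ = 1 ∧ ‖a i - (l : PadicAlgCl p) * a j‖ = 1)) → MatsumotoBox K n p ρ → ∀ v : HeightOneSpectrum (𝓞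 K), ((p : ℕ) : 𝓞 K) ∉ v.asIdeal → ∃ W : WeilDeligneRep (v.adicCompletion K) (PadicAlgCl p) (Fin n → PadicAlgCl p), IsWeilDeligneOfLadic (ρ.toLocal v).toWeilGroupHom W ∧ ∀ f : (Fin n → PadicAlgCl p) →ₗ[PadicAlgCl p] (Fin n → PadicAlgCl p), (∀ w : WeilGroup (v.adicCompletion K), f ∘ₗ W.ρ w = ((IsNonarchimedeanLocalField.residueFieldCard (v.adicCompletion K) : PadicAlgCl p) ^ (WeilGroup.deg w)) • (W.ρ w ∘ₗ f)) → f ∘ₗ W.N = W.N ∘ₗ f → f = 0) := Iff.rfl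

/-- **ROOT**: the two cells and the host route's other items give `Langlands`, through the host's landed deciding theorem
`ParahoricFibre.closes`. [folklore] -/
theorem root_of_cells (hB : OrdinaryBoxGenericMonodromy) (hO : OffOrdinaryBoxGenericMonodromy)
    (hOcc : Summit.Langlands.Langlands.Theses.ParahoricFibre.ParahoricOccurrence) (hOG : Summit.Langlands.Langlands.Theses.ParahoricFibre.OccurrenceToGeneric)
    (hJ : Summit.Langlands.Langlands.Theses.ParahoricFibre.MonodromyToLanglands) (hA : Summit.Langlands.Langlands.Theses.ParahoricFibre.Assembly) : _root_.Langlands :=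
  Summit.Langlands.Langlands.Theses.ParahoricFibre.closes hOcc hOG (smallRange_of_cells hB hO) hJ hA

/-! ## ORDBOX line (BC3): stub P (potential ordinary genericity = Matsumoto 5.22 ∘ AHTW 6.0.5 in T's currency) + stub D
(descent of genericity along `W_{F'_u} ⊂ W_{K_v}`) ⇒ ORDBOX, composition kernel-checked -/

section OrdinaryBoxLine

/-- Stub P of the ORDBOX line (registered on stmt-Langlands-27894, `Lines/birth.lean` stub 1; a seat-assembled composite in T's currency, NOT a
published statement — see the module docstring for the two print inputs it composes): POTENTIAL ORDINARY GENERICITY — for MB data, over SOME finite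
extension `F'/K` every Weil–Deligne representation attached to `ρ|_{W_{F'_u}}`, `u ∤ p`, is generic. -/
def PotentialOrdinaryGenericity : Prop :=
  open IsDedekindDomain NumberField Polynomial Filter Literature.NumberTheory.Automorphic Literature.NumberTheory.GaloisRepresentations in ∀ (K : Type) [Field K] [NumberField K], NumberField.IsCMField K → ∀ (n : ℕ) (hcpt : isCompact_glFiniteIntegralLevel n K) (π : CuspidalAutomorphicRepData n K hcpt), π.1.IsRegularAlgebraic → ∀ (p : ℕ) [Fact p.Prime] (ι : PadicAlgCl p ≃+* ℂ) (ρ : FramedGaloisRep K (PadicAlgCl p) n), ρ.toGaloisRep.IsSemisimple → (∀ᶠ v : HeightOneSpectrum (𝓞 K) in cofinite, ∀ α : Multiset ℂ, π.1.HasSatakeParamAt v α → ρ.IsUnramifiedAt v ∧ ρ.HasFrobCharpolyAt v (arithFrobPolyOfSatake ι v.residueCard n α)) → (n ^ 2 < p ∧ (¬ ∃ ζ : K, IsPrimitiveRoot ζ p) ∧ (ρ.restrictField (CyclotomicField p K)).IsResiduallyAbsIrreducible ∧ (∃ l : ℕ, l.Prime ∧ l ≠ p ∧ ¬ (p ∣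 (l - 1)) ∧ ¬ ((l : ℤ) ∣ NumberField.discr K) ∧ ∀ w : HeightOneSpectrum (𝓞 K), ((l : ℕ) : 𝓞 K) ∈ w.asIdeal → w.residueCard = l ∧ ρ.IsUnramifiedAt w ∧ ∃ a : Fin n → PadicAlgCl p, ρ.HasFrobCharpolyAt w (∏ i, (X - C (a i))) ∧ ∀ i j : Fin n, i ≠ j → ‖a i - (l : PadicAlgCl p) * a j‖ = 1) ∧ (∀ w : HeightOneSpectrum (𝓞 K), ((p : ℕ) : 𝓞 K) ∈ w.asIdeal → ∀ art : LocalArtinData (w.adicCompletion K), art.IsCanonical → ρ.IsOrdinaryRegularAt w art)) → ∃ (F' : Type) (_ : Field F') (_ : NumberField F') (_ : Algebra K F'), ∀ u : HeightOneSpectrum (𝓞 F'), ((p : ℕ) : 𝓞 F') ∉ u.asIdeal → ∃ W' : WeilDeligneRep (u.adicCompletion F') (PadicAlgCl p) (Fin n → PadicAlgCl p), IsWeilDeligneOfLadic ((ρ.restrictField F').toLocal u).toWeilGroupHom W' ∧ ∀ f : (Fin n → PadicAlgCl p) →ₗ[PadicAlgCl p] (Fin n → PadicAlgCl p), (∀ w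 : WeilGroup (u.adicCompletion F'), f ∘ₗ W'.ρ w = ((IsNonarchimedeanLocalField.residueFieldCard (u.adicCompletion F') : PadicAlgCl p) ^ (WeilGroup.deg w)) • (W'.ρ w ∘ₗ f)) → f ∘ₗ W'.N = W'.N ∘ₗ f → f = 0

/-- Stub D of the ORDBOX line (registered on stmt-Langlands-27894, `Lines/birth.lean` stub 2; pure local algebra, provable in the tree, NOT a published
statement): DESCENT OF GENERICITY — for a finite `F'/K` and places `u ∣ v ∤ p`, if some Weil–Deligne representation attached to `(ρ|_{Γ_{F'}})|_{W_{F'_u}}`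
is generic then some Weil–Deligne representation attached to `ρ|_{W_{K_v}}` is generic. -/
def GenericityDescends : Prop :=
  open IsDedekindDomain NumberField Polynomial Filter Literature.NumberTheory.Automorphic Literature.NumberTheory.GaloisRepresentations in ∀ (K : Type) [Field K] [NumberField K] (F' : Type) [Field F'] [NumberField F'] [Algebra K F'] (p n : ℕ) [Fact p.Prime] (ρ : FramedGaloisRep K (PadicAlgCl p) n) (v : HeightOneSpectrum (𝓞 K)) (u : HeightOneSpectrum (𝓞 F')), u.asIdeal.comap (algebraMap (𝓞 K) (𝓞 F')) = v.asIdeal → ((p : ℕ) : 𝓞 K) ∉ v.asIdeal → (∃ W' : WeilDeligneRep (u.adicCompletion F') (PadicAlgCl p) (Fin n → PadicAlgCl p), IsWeilDeligneOfLadic ((ρ.restrictField F').toLocal u).toWeilGroupHom W' ∧ ∀ f : (Fin n → PadicAlgCl p) →ₗ[PadicAlgCl p] (Fin n → PadicAlgCl p), (∀ w : WeilGroup (u.adicCompletion F'), f ∘ₗ W'.ρ w = ((IsNonarchimedeanLocalField.residueFieldCard (u.adicCompletion F') : PadicAlgCl p) ^ (WeilGroup.deg w)) • (W'.ρ w ∘ₗ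 f)) → f ∘ₗ W'.N = W'.N ∘ₗ f → f = 0) → ∃ W : WeilDeligneRep (v.adicCompletion K) (PadicAlgCl p) (Fin n → PadicAlgCl p), IsWeilDeligneOfLadic (ρ.toLocal v).toWeilGroupHom W ∧ ∀ f : (Fin n → PadicAlgCl p) →ₗ[PadicAlgCl p] (Fin n → PadicAlgCl p), (∀ w : WeilGroup (v.adicCompletion K), f ∘ₗ W.ρ w = ((IsNonarchimedeanLocalField.residueFieldCard (v.adicCompletion K) : PadicAlgCl p) ^ (WeilGroup.deg w)) • (W.ρ w ∘ₗ f)) → f ∘ₗ W.N = W.N ∘ₗ f → f = 0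

open IsDedekindDomain Literature.NumberTheory.GaloisRepresentations in
/-- **ORDBOX from the line**: P → D ⇒ `OrdinaryBoxGenericMonodromy` — choose a place `u` of `F'` above `v` by going-up for the integral extension
`𝓞 K → 𝓞 F'` (`Ideal.exists_ideal_over_maximal_of_isIntegral`), note `p ∉ u`, and descend genericity from `u` to `v`. [folklore] -/
theorem ordbox_of_line (hP : PotentialOrdinaryGenericity) (hD : GenericityDescends) : OrdinaryBoxGenericMonodromy := by
  intro K _ _ hK n hcpt π hπ p _ ι ρ hss hsat hoff hMB v hv
  obtain ⟨F', iF, iNF, iA, hup⟩ := hP K hK n hcpt π hπ p ι ρ hss hsat hMB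
  have hker : RingHom.ker (algebraMap (𝓞 K) (𝓞 F')) ≤ v.asIdeal := by
    rw [NumberField.RingOfIntegers.ker_algebraMap_eq_bot K F']
    exact bot_le
  obtain ⟨Q, hQmax, hQ⟩ := Ideal.exists_ideal_over_maximal_of_isIntegral v.asIdeal hker
  have hQne : Q ≠ ⊥ := by
    rintro rfl
    apply v.ne_bot
    rw [← hQ]
    exact NumberField.RingOfIntegers.ker_algebraMap_eq_bot K F'
  let u : HeightOneSpectrum (𝓞 F') := ⟨Q, hQmax.isPrime, hQne⟩
  have hu : ((p : ℕ) : 𝓞 F') ∉ u.asIdeal := by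
    intro hpu
    apply hv
    rw [← hQ, Ideal.mem_comap, map_natCast]
    exact hpu
  exact hD K F' p n ρ v u hQ hv (hup u hu)

end OrdinaryBoxLine

/-! ## OFFBOX seam (BC3): the parent's registered birth skeleton, re-homed to the residual (statements verbatim from
`Cruxes/SmallRangeGenericMonodromy/Lines/birth.lean`, `¬MB` inserted after `ρ`'s Satake clause) -/

section OffBoxSeam

/-- parent stub S1 (genericity prime switch = `ℓ`-independence of `N` at `v ∤ pp'`; the OPEN core), verbatim up to unfolding `W.IsGeneric` into the
host's inline clause (`WeilDeligneRep.isGeneric_iff = Iff.rfl`; the module `WeilDeligneGeneric` is not imported). -/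
def GenericityPrimeSwitch : Prop :=
  open IsDedekindDomain NumberField Polynomial Filter Literature.NumberTheory.Automorphic Literature.NumberTheory.GaloisRepresentations in ∀ (K : Type) [Field K] [NumberField K], NumberField.IsCMField K → ∀ (n : ℕ) (hcpt : isCompact_glFiniteIntegralLevel n K) (π : CuspidalAutomorphicRepData n K hcpt), π.1.IsRegularAlgebraic → ∀ (p : ℕ) [Fact p.Prime] (ι : PadicAlgCl p ≃+* ℂ) (ρ : FramedGaloisRep K (PadicAlgCl p) n), ρ.toGaloisRep.IsSemisimple → (∀ᶠ v : HeightOneSpectrum (𝓞 K) in cofinite, ∀ α : Multiset ℂ, π.1.HasSatakeParamAt v α → ρ.IsUnramifiedAt v ∧ ρ.HasFrobCharpolyAt v (arithFrobPolyOfSatake ι v.residueCard n α)) → ∀ (p' : ℕ) [Fact p'.Prime] (ι' : PadicAlgCl p' ≃+* ℂ) (ρ' : FramedGaloisRep K (PadicAlgCl p') n), ρ'.toGaloisRep.IsSemisimple → (∀ᶠ v : HeightOneSpectrum (𝓞 K) in cofinite, ∀ α : Multiset ℂ, π.1.HasSatakeParamAt v α → ρ'.IsUnramifiedAt v ∧ ρ'.HasFrobCharpolyAt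 v (arithFrobPolyOfSatake ι' v.residueCard n α)) → (n ^ 2 < p' ∧ ¬ ((p' : ℤ) ∣ NumberField.discr K) ∧ (∀ w : HeightOneSpectrum (𝓞 K), ((p' : ℕ) : 𝓞 K) ∈ w.asIdeal → π.1.IsUnramifiedAt w) ∧ (∃ g : GL (Fin n) (PadicAlgCl p'), (∀ (σ : Field.absoluteGaloisGroup K) (i j : Fin n), ‖((g * ρ' σ * g⁻¹ : GL (Fin n) (PadicAlgCl p')) : Matrix (Fin n) (Fin n) (PadicAlgCl p')) i j‖ ≤ 1) ∧ (∀ M : Matrix (Fin n) (Fin n) ℤ, M.det = 1 → ∃ σ : Field.absoluteGaloisGroup K, ∀ i j : Fin n, ‖((g * ρ' σ * g⁻¹ : GL (Fin n) (PadicAlgCl p')) : Matrix (Fin n) (Fin n) (PadicAlgCl p')) i j - ((M i j : ℤ) : PadicAlgCl p')‖ < 1)) ∧ (∃ l : ℕ, l.Prime ∧ l ≠ p' ∧ ∀ w : HeightOneSpectrum (𝓞 K), ((l : ℕ) : 𝓞 K) ∈ w.asIdeal → w.residueCard = l ∧ ρ'.IsUnramifiedAt w ∧ ∃ a : Fin n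 → PadicAlgCl p', ρ'.HasFrobCharpolyAt w (∏ i, (X - C (a i))) ∧ ∀ i j : Fin n, i ≠ j → ‖a i - a j‖ = 1 ∧ ‖a i - (l : PadicAlgCl p') * a j‖ = 1)) → ∀ v : HeightOneSpectrum (𝓞 K), ((p : ℕ) : 𝓞 K) ∉ v.asIdeal → ((p' : ℕ) : 𝓞 K) ∉ v.asIdeal → (∃ W : WeilDeligneRep (v.adicCompletion K) (PadicAlgCl p') (Fin n → PadicAlgCl p'), IsWeilDeligneOfLadic (ρ'.toLocal v).toWeilGroupHom W ∧ ∀ f : (Fin n → PadicAlgCl p') →ₗ[PadicAlgCl p'] (Fin n → PadicAlgCl p'), (∀ w : WeilGroup (v.adicCompletion K), f ∘ₗ W.ρ w = ((IsNonarchimedeanLocalField.residueFieldCard (v.adicCompletion K) : PadicAlgCl p') ^ (WeilGroup.deg w)) • (W.ρ w ∘ₗ f)) → f ∘ₗ W.N = W.N ∘ₗ f → f = 0) → ∃ W : WeilDeligneRep (v.adicCompletion K) (PadicAlgCl p) (Fin n → PadicAlgCl p), IsWeilDeligneOfLadic (ρ.toLocal v).toWeilGroupHom W ∧ ∀ f :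 (Fin n → PadicAlgCl p) →ₗ[PadicAlgCl p] (Fin n → PadicAlgCl p), (∀ w : WeilGroup (v.adicCompletion K), f ∘ₗ W.ρ w = ((IsNonarchimedeanLocalField.residueFieldCard (v.adicCompletion K) : PadicAlgCl p) ^ (WeilGroup.deg w)) • (W.ρ w ∘ₗ f)) → f ∘ₗ W.N = W.N ∘ₗ f → f = 0

/-- parent stub S2 (genericity for `π` of small monodromy), verbatim up to the same unfolding. -/
def SmallMonodromyGeneric : Prop :=
  open IsDedekindDomain NumberField Polynomial Filter Literature.NumberTheory.Automorphic Literature.NumberTheory.GaloisRepresentations in ∀ (K : Type) [Field K] [NumberField K], NumberField.IsCMField K → ∀ (n : ℕ) (hcpt : isCompact_glFiniteIntegralLevel n K) (π : CuspidalAutomorphicRepData n K hcpt), π.1.IsRegularAlgebraic → ∀ (p : ℕ) [Fact p.Prime] (ι : PadicAlgCl p ≃+* ℂ) (ρ : FramedGaloisRep K (PadicAlgCl p) n), ρ.toGaloisRep.IsSemisimple → (∀ᶠ v : HeightOneSpectrum (𝓞 K) in cofinite, ∀ α : Multiset ℂ, π.1.HasSatakeParamAt v α → ρ.IsUnramifiedAt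 v ∧ ρ.HasFrobCharpolyAt v (arithFrobPolyOfSatake ι v.residueCard n α)) → ∀ v : HeightOneSpectrum (𝓞 K), ((p : ℕ) : 𝓞 K) ∉ v.asIdeal → (∀ (p' : ℕ) [Fact p'.Prime] (ι' : PadicAlgCl p' ≃+* ℂ) (ρ' : FramedGaloisRep K (PadicAlgCl p') n), ρ'.toGaloisRep.IsSemisimple → (∀ᶠ v : HeightOneSpectrum (𝓞 K) in cofinite, ∀ α : Multiset ℂ, π.1.HasSatakeParamAt v α → ρ'.IsUnramifiedAt v ∧ ρ'.HasFrobCharpolyAt v (arithFrobPolyOfSatake ι' v.residueCard n α)) → ((p' : ℕ) : 𝓞 K) ∉ v.asIdeal → ¬ (n ^ 2 < p' ∧ ¬ ((p' : ℤ) ∣ NumberField.discr K) ∧ (∀ w : HeightOneSpectrum (𝓞 K), ((p' : ℕ) : 𝓞 K) ∈ w.asIdeal → π.1.IsUnramifiedAt w) ∧ (∃ g : GL (Fin n) (PadicAlgCl p'), (∀ (σ : Field.absoluteGaloisGroup K) (i j : Fin n), ‖((g * ρ' σ * g⁻¹ : GL (Fin n) (PadicAlgCl p')) : Matrix (Fin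 n) (Fin n) (PadicAlgCl p')) i j‖ ≤ 1) ∧ (∀ M : Matrix (Fin n) (Fin n) ℤ, M.det = 1 → ∃ σ : Field.absoluteGaloisGroup K, ∀ i j : Fin n, ‖((g * ρ' σ * g⁻¹ : GL (Fin n) (PadicAlgCl p')) : Matrix (Fin n) (Fin n) (PadicAlgCl p')) i j - ((M i j : ℤ) : PadicAlgCl p')‖ < 1)) ∧ (∃ l : ℕ, l.Prime ∧ l ≠ p' ∧ ∀ w : HeightOneSpectrum (𝓞 K), ((l : ℕ) : 𝓞 K) ∈ w.asIdeal → w.residueCard = l ∧ ρ'.IsUnramifiedAt w ∧ ∃ a : Fin n → PadicAlgCl p', ρ'.HasFrobCharpolyAt w (∏ i, (X - C (a i))) ∧ ∀ i j : Fin n, i ≠ j → ‖a i - a j‖ = 1 ∧ ‖a i - (l : PadicAlgCl p') * a j‖ = 1))) → ∃ W : WeilDeligneRep (v.adicCompletion K) (PadicAlgCl p) (Fin n → PadicAlgCl p), IsWeilDeligneOfLadic (ρ.toLocal v).toWeilGroupHom W ∧ ∀ f : (Fin n → PadicAlgCl p) →ₗ[PadicAlgCl p] (Fin n → PadicAlgCl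 p), (∀ w : WeilGroup (v.adicCompletion K), f ∘ₗ W.ρ w = ((IsNonarchimedeanLocalField.residueFieldCard (v.adicCompletion K) : PadicAlgCl p) ^ (WeilGroup.deg w)) • (W.ρ w ∘ₗ f)) → f ∘ₗ W.N = W.N ∘ₗ f → f = 0

/-- S1 ∣ OFFBOX: the prime switch for off-box data `(p, ρ)`. -/
def OffBoxGenericityPrimeSwitch : Prop :=
  open IsDedekindDomain NumberField Polynomial Filter Literature.NumberTheory.Automorphic Literature.NumberTheory.GaloisRepresentations in ∀ (K : Type) [Field K] [NumberField K], NumberField.IsCMField K → ∀ (n : ℕ) (hcpt : isCompact_glFiniteIntegralLevel n K) (π : CuspidalAutomorphicRepData n K hcpt), π.1.IsRegularAlgebraic → ∀ (p : ℕ) [Fact p.Prime] (ι : PadicAlgCl p ≃+* ℂ) (ρ : FramedGaloisRep K (PadicAlgCl p) n), ρ.toGaloisRep.IsSemisimple → (∀ᶠ v : HeightOneSpectrum (𝓞 K) in cofinite, ∀ α : Multiset ℂ, π.1.HasSatakeParamAt v α → ρ.IsUnramifiedAt v ∧ ρ.HasFrobCharpolyAt v (arithFrobPolyOfSatake ι v.residueCard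 n α)) → ¬ (n ^ 2 < p ∧ (¬ ∃ ζ : K, IsPrimitiveRoot ζ p) ∧ (ρ.restrictField (CyclotomicField p K)).IsResiduallyAbsIrreducible ∧ (∃ l : ℕ, l.Prime ∧ l ≠ p ∧ ¬ (p ∣ (l - 1)) ∧ ¬ ((l : ℤ) ∣ NumberField.discr K) ∧ ∀ w : HeightOneSpectrum (𝓞 K), ((l : ℕ) : 𝓞 K) ∈ w.asIdeal → w.residueCard = l ∧ ρ.IsUnramifiedAt w ∧ ∃ a : Fin n → PadicAlgCl p, ρ.HasFrobCharpolyAt w (∏ i, (X - C (a i))) ∧ ∀ i j : Fin n, i ≠ j → ‖a i - (l : PadicAlgCl p) * a j‖ = 1) ∧ (∀ w : HeightOneSpectrum (𝓞 K), ((p : ℕ) : 𝓞 K) ∈ w.asIdeal → ∀ art : LocalArtinData (w.adicCompletion K), art.IsCanonical → ρ.IsOrdinaryRegularAt w art)) → ∀ (p' : ℕ) [Fact p'.Prime] (ι' : PadicAlgCl p' ≃+* ℂ) (ρ' : FramedGaloisRep K (PadicAlgCl p') n), ρ'.toGaloisRep.IsSemisimple → (∀ᶠ v : HeightOneSpectrum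 (𝓞 K) in cofinite, ∀ α : Multiset ℂ, π.1.HasSatakeParamAt v α → ρ'.IsUnramifiedAt v ∧ ρ'.HasFrobCharpolyAt v (arithFrobPolyOfSatake ι' v.residueCard n α)) → (n ^ 2 < p' ∧ ¬ ((p' : ℤ) ∣ NumberField.discr K) ∧ (∀ w : HeightOneSpectrum (𝓞 K), ((p' : ℕ) : 𝓞 K) ∈ w.asIdeal → π.1.IsUnramifiedAt w) ∧ (∃ g : GL (Fin n) (PadicAlgCl p'), (∀ (σ : Field.absoluteGaloisGroup K) (i j : Fin n), ‖((g * ρ' σ * g⁻¹ : GL (Fin n) (PadicAlgCl p')) : Matrix (Fin n) (Fin n) (PadicAlgCl p')) i j‖ ≤ 1) ∧ (∀ M : Matrix (Fin n) (Fin n) ℤ, M.det = 1 → ∃ σ : Field.absoluteGaloisGroup K, ∀ i j : Fin n, ‖((g * ρ' σ * g⁻¹ : GL (Fin n) (PadicAlgCl p')) : Matrix (Fin n) (Fin n) (PadicAlgCl p')) i j - ((M i j : ℤ) : PadicAlgCl p')‖ < 1)) ∧ (∃ l : ℕ, l.Prime ∧ l ≠ p' ∧ ∀ w : HeightOneSpectrum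 (𝓞 K), ((l : ℕ) : 𝓞 K) ∈ w.asIdeal → w.residueCard = l ∧ ρ'.IsUnramifiedAt w ∧ ∃ a : Fin n → PadicAlgCl p', ρ'.HasFrobCharpolyAt w (∏ i, (X - C (a i))) ∧ ∀ i j : Fin n, i ≠ j → ‖a i - a j‖ = 1 ∧ ‖a i - (l : PadicAlgCl p') * a j‖ = 1)) → ∀ v : HeightOneSpectrum (𝓞 K), ((p : ℕ) : 𝓞 K) ∉ v.asIdeal → ((p' : ℕ) : 𝓞 K) ∉ v.asIdeal → (∃ W : WeilDeligneRep (v.adicCompletion K) (PadicAlgCl p') (Fin n → PadicAlgCl p'), IsWeilDeligneOfLadic (ρ'.toLocal v).toWeilGroupHom W ∧ ∀ f : (Fin n → PadicAlgCl p') →ₗ[PadicAlgCl p'] (Fin n → PadicAlgCl p'), (∀ w : WeilGroup (v.adicCompletion K), f ∘ₗ W.ρ w = ((IsNonarchimedeanLocalField.residueFieldCard (v.adicCompletion K) : PadicAlgCl p') ^ (WeilGroup.deg w)) • (W.ρ w ∘ₗ f)) → f ∘ₗ W.N = W.N ∘ₗ f → f = 0) → ∃ W : WeilDeligneRep (v.adicCompletion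 K) (PadicAlgCl p) (Fin n → PadicAlgCl p), IsWeilDeligneOfLadic (ρ.toLocal v).toWeilGroupHom W ∧ ∀ f : (Fin n → PadicAlgCl p) →ₗ[PadicAlgCl p] (Fin n → PadicAlgCl p), (∀ w : WeilGroup (v.adicCompletion K), f ∘ₗ W.ρ w = ((IsNonarchimedeanLocalField.residueFieldCard (v.adicCompletion K) : PadicAlgCl p) ^ (WeilGroup.deg w)) • (W.ρ w ∘ₗ f)) → f ∘ₗ W.N = W.N ∘ₗ f → f = 0

/-- S2 ∣ OFFBOX: small-monodromy genericity for off-box data `(p, ρ)`. -/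
def OffBoxSmallMonodromyGeneric : Prop :=
  open IsDedekindDomain NumberField Polynomial Filter Literature.NumberTheory.Automorphic Literature.NumberTheory.GaloisRepresentations in ∀ (K : Type) [Field K] [NumberField K], NumberField.IsCMField K → ∀ (n : ℕ) (hcpt : isCompact_glFiniteIntegralLevel n K) (π : CuspidalAutomorphicRepData n K hcpt), π.1.IsRegularAlgebraic → ∀ (p : ℕ) [Fact p.Prime] (ι : PadicAlgCl p ≃+* ℂ) (ρ : FramedGaloisRep K (PadicAlgCl p) n), ρ.toGaloisRep.IsSemisimple → (∀ᶠ v : HeightOneSpectrum (𝓞 K) in cofinite, ∀ α : Multiset ℂ, π.1.HasSatakeParamAt v α → ρ.IsUnramifiedAt v ∧ ρ.HasFrobCharpolyAt v (arithFrobPolyOfSatake ι v.residueCard n α)) → ¬ (n ^ 2 < p ∧ (¬ ∃ ζ : K, IsPrimitiveRoot ζ p) ∧ (ρ.restrictField (CyclotomicField p K)).IsResiduallyAbsIrreducible ∧ (∃ l : ℕ, l.Prime ∧ l ≠ p ∧ ¬ (p ∣ (l - 1)) ∧ ¬ ((l : ℤ) ∣ NumberField.discr K) ∧ ∀ w : HeightOneSpectrum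 (𝓞 K), ((l : ℕ) : 𝓞 K) ∈ w.asIdeal → w.residueCard = l ∧ ρ.IsUnramifiedAt w ∧ ∃ a : Fin n → PadicAlgCl p, ρ.HasFrobCharpolyAt w (∏ i, (X - C (a i))) ∧ ∀ i j : Fin n, i ≠ j → ‖a i - (l : PadicAlgCl p) * a j‖ = 1) ∧ (∀ w : HeightOneSpectrum (𝓞 K), ((p : ℕ) : 𝓞 K) ∈ w.asIdeal → ∀ art : LocalArtinData (w.adicCompletion K), art.IsCanonical → ρ.IsOrdinaryRegularAt w art)) → ∀ v : HeightOneSpectrum (𝓞 K), ((p : ℕ) : 𝓞 K) ∉ v.asIdeal → (∀ (p' : ℕ) [Fact p'.Prime] (ι' : PadicAlgCl p' ≃+* ℂ) (ρ' : FramedGaloisRep K (PadicAlgCl p') n), ρ'.toGaloisRep.IsSemisimple → (∀ᶠ v : HeightOneSpectrum (𝓞 K) in cofinite, ∀ α : Multiset ℂ, π.1.HasSatakeParamAt v α → ρ'.IsUnramifiedAt v ∧ ρ'.HasFrobCharpolyAt v (arithFrobPolyOfSatake ι' v.residueCard n α)) → ((p' : ℕ) : 𝓞 K) ∉ v.asIdeal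 → ¬ (n ^ 2 < p' ∧ ¬ ((p' : ℤ) ∣ NumberField.discr K) ∧ (∀ w : HeightOneSpectrum (𝓞 K), ((p' : ℕ) : 𝓞 K) ∈ w.asIdeal → π.1.IsUnramifiedAt w) ∧ (∃ g : GL (Fin n) (PadicAlgCl p'), (∀ (σ : Field.absoluteGaloisGroup K) (i j : Fin n), ‖((g * ρ' σ * g⁻¹ : GL (Fin n) (PadicAlgCl p')) : Matrix (Fin n) (Fin n) (PadicAlgCl p')) i j‖ ≤ 1) ∧ (∀ M : Matrix (Fin n) (Fin n) ℤ, M.det = 1 → ∃ σ : Field.absoluteGaloisGroup K, ∀ i j : Fin n, ‖((g * ρ' σ * g⁻¹ : GL (Fin n) (PadicAlgCl p')) : Matrix (Fin n) (Fin n) (PadicAlgCl p')) i j - ((M i j : ℤ) : PadicAlgCl p')‖ < 1)) ∧ (∃ l : ℕ, l.Prime ∧ l ≠ p' ∧ ∀ w : HeightOneSpectrum (𝓞 K), ((l : ℕ) : 𝓞 K) ∈ w.asIdeal → w.residueCard = l ∧ ρ'.IsUnramifiedAt w ∧ ∃ a : Fin n → PadicAlgCl p', ρ'.HasFrobCharpolyAt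 w (∏ i, (X - C (a i))) ∧ ∀ i j : Fin n, i ≠ j → ‖a i - a j‖ = 1 ∧ ‖a i - (l : PadicAlgCl p') * a j‖ = 1))) → ∃ W : WeilDeligneRep (v.adicCompletion K) (PadicAlgCl p) (Fin n → PadicAlgCl p), IsWeilDeligneOfLadic (ρ.toLocal v).toWeilGroupHom W ∧ ∀ f : (Fin n → PadicAlgCl p) →ₗ[PadicAlgCl p] (Fin n → PadicAlgCl p), (∀ w : WeilGroup (v.adicCompletion K), f ∘ₗ W.ρ w = ((IsNonarchimedeanLocalField.residueFieldCard (v.adicCompletion K) : PadicAlgCl p) ^ (WeilGroup.deg w)) • (W.ρ w ∘ₗ f)) → f ∘ₗ W.N = W.N ∘ₗ f → f = 0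

/-- S1 ⇒ S1∣OFFBOX (restriction). [folklore] -/
theorem offBoxPrimeSwitch_of (h : GenericityPrimeSwitch) : OffBoxGenericityPrimeSwitch :=
  fun K _ _ hK n hcpt π hπ p _ ι ρ hss hsat _ => h K hK n hcpt π hπ p ι ρ hss hsat

/-- S2 ⇒ S2∣OFFBOX (restriction). [folklore] -/
theorem offBoxSmallMonodromy_of (h : SmallMonodromyGeneric) : OffBoxSmallMonodromyGeneric :=
  fun K _ _ hK n hcpt π hπ p _ ι ρ hss hsat _ => h K hK n hcpt π hπ p ι ρ hss hsat

open IsDedekindDomain Polynomial Literature.NumberTheory.Automorphic Literature.NumberTheory.GaloisRepresentations in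
/-- **OFFBOX from the parent's seam**: `ParahoricOccurrence → OccurrenceToGeneric → S1∣OFFBOX → S2∣OFFBOX ⇒ OFFBOX` — the parent's
composition (dichotomy by `π`: some patching datum `(p', ι', ρ')` with `p' ∤ v` exists, or none) re-proved with `¬MB` threaded. [folklore] -/
theorem offbox_of_seam (hOcc : Summit.Langlands.Langlands.Theses.ParahoricFibre.ParahoricOccurrence) (hOG : Summit.Langlands.Langlands.Theses.ParahoricFibre.OccurrenceToGeneric)
    (h₁ : OffBoxGenericityPrimeSwitch) (h₂ : OffBoxSmallMonodromyGeneric) : OffOrdinaryBoxGenericMonodromy := by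
  intro K _ _ hK n hcpt π hπ p _ ι ρ hss hsat _hoff hMB v hv
  by_cases hfull :
      ∃ (p' : ℕ) (_ : Fact p'.Prime) (ι' : PadicAlgCl p' ≃+* ℂ) (ρ' : FramedGaloisRep K (PadicAlgCl
      p') n), ρ'.toGaloisRep.IsSemisimple ∧ (∀ᶠ v : HeightOneSpectrum (𝓞 K) in cofinite, ∀ α :
      Multiset ℂ, π.1.HasSatakeParamAt v α → ρ'.IsUnramifiedAt v ∧ ρ'.HasFrobCharpolyAt v
      (arithFrobPolyOfSatake ι' v.residueCard n α)) ∧ ((p' : ℕ) : 𝓞 K) ∉ v.asIdeal ∧ (n ^ 2 < p' ∧ ¬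
      ((p' : ℤ) ∣ NumberField.discr K) ∧ (∀ w : HeightOneSpectrum (𝓞 K), ((p' : ℕ) : 𝓞 K) ∈
      w.asIdeal → π.1.IsUnramifiedAt w) ∧ (∃ g : GL (Fin n) (PadicAlgCl p'), (∀ (σ :
      Field.absoluteGaloisGroup K) (i j : Fin n), ‖((g * ρ' σ * g⁻¹ : GL (Fin n) (PadicAlgCl p')) :
      Matrix (Fin n) (Fin n) (PadicAlgCl p')) i j‖ ≤ 1) ∧ (∀ M : Matrix (Fin n) (Fin n) ℤ, M.det = 1
      → ∃ σ : Field.absoluteGaloisGroup K, ∀ i j : Fin n, ‖((g * ρ' σ * g⁻¹ : GL (Fin n) (PadicAlgCl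
      p')) : Matrix (Fin n) (Fin n) (PadicAlgCl p')) i j - ((M i j : ℤ) : PadicAlgCl p')‖ < 1)) ∧ (∃
      l : ℕ, l.Prime ∧ l ≠ p' ∧ ∀ w : HeightOneSpectrum (𝓞 K), ((l : ℕ) : 𝓞 K) ∈ w.asIdeal →
      w.residueCard = l ∧ ρ'.IsUnramifiedAt w ∧ ∃ a : Fin n → PadicAlgCl p', ρ'.HasFrobCharpolyAt w
      (∏ i, (X - C (a i))) ∧ ∀ i j : Fin n, i ≠ j → ‖a i - a j‖ = 1 ∧ ‖a i - (l : PadicAlgCl p') * a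
      j‖ = 1))
  · obtain ⟨p', hp', ι', ρ', hss', hsat', hv', hrange'⟩ := hfull
    obtain ⟨W', hW', hgen'⟩ := hOG hOcc K hK n hcpt π hπ p' ι' ρ' hss' hsat' hrange' v hv'
    obtain ⟨W, hW, hgen⟩ := h₁ K hK n hcpt π hπ p ι ρ hss hsat hMB p' ι' ρ' hss' hsat' hrange' v hv hv'
      ⟨W', hW', hgen'⟩
    exact ⟨W, hW, hgen⟩
  · obtain ⟨W, hW, hgen⟩ := h₂ K hK n hcpt π hπ p ι ρ hss hsat hMB v hv (by
      intro p' hp' ι' ρ' hss' hsat' hv' hrange'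
      exact hfull ⟨p', hp', ι', ρ', hss', hsat', hv', hrange'⟩)
    exact ⟨W, hW, hgen⟩

open IsDedekindDomain Polynomial Literature.NumberTheory.Automorphic Literature.NumberTheory.GaloisRepresentations in
/-- **The parent's composition, verbatim** (`ParahoricOccurrence → OccurrenceToGeneric → S1 → S2 ⇒ T`), re-proved so that nothing with a
`sorry` is imported; with `offBoxPrimeSwitch_of`, `offBoxSmallMonodromy_of` it shows the residual inherits the parent's only registered line. [folklore] -/
theorem target_of_parent_seam (hOcc : Summit.Langlands.Langlands.Theses.ParahoricFibre.ParahoricOccurrence) (hOG : Summit.Langlands.Langlands.Theses.ParahoricFibre.OccurrenceToGeneric)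
    (h₁ : GenericityPrimeSwitch) (h₂ : SmallMonodromyGeneric) : Summit.Langlands.Langlands.Theses.ParahoricFibre.SmallRangeGenericMonodromy := by
  intro K _ _ hK n hcpt π hπ p _ ι ρ hss hsat _hoff v hv
  by_cases hfull :
      ∃ (p' : ℕ) (_ : Fact p'.Prime) (ι' : PadicAlgCl p' ≃+* ℂ) (ρ' : FramedGaloisRep K (PadicAlgCl
      p') n), ρ'.toGaloisRep.IsSemisimple ∧ (∀ᶠ v : HeightOneSpectrum (𝓞 K) in cofinite, ∀ α :
      Multiset ℂ, π.1.HasSatakeParamAt v α → ρ'.IsUnramifiedAt v ∧ ρ'.HasFrobCharpolyAt v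
      (arithFrobPolyOfSatake ι' v.residueCard n α)) ∧ ((p' : ℕ) : 𝓞 K) ∉ v.asIdeal ∧ (n ^ 2 < p' ∧ ¬
      ((p' : ℤ) ∣ NumberField.discr K) ∧ (∀ w : HeightOneSpectrum (𝓞 K), ((p' : ℕ) : 𝓞 K) ∈
      w.asIdeal → π.1.IsUnramifiedAt w) ∧ (∃ g : GL (Fin n) (PadicAlgCl p'), (∀ (σ :
      Field.absoluteGaloisGroup K) (i j : Fin n), ‖((g * ρ' σ * g⁻¹ : GL (Fin n) (PadicAlgCl p')) :
      Matrix (Fin n) (Fin n) (PadicAlgCl p')) i j‖ ≤ 1) ∧ (∀ M : Matrix (Fin n) (Fin n) ℤ, M.det = 1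
      → ∃ σ : Field.absoluteGaloisGroup K, ∀ i j : Fin n, ‖((g * ρ' σ * g⁻¹ : GL (Fin n) (PadicAlgCl
      p')) : Matrix (Fin n) (Fin n) (PadicAlgCl p')) i j - ((M i j : ℤ) : PadicAlgCl p')‖ < 1)) ∧ (∃
      l : ℕ, l.Prime ∧ l ≠ p' ∧ ∀ w : HeightOneSpectrum (𝓞 K), ((l : ℕ) : 𝓞 K) ∈ w.asIdeal →
      w.residueCard = l ∧ ρ'.IsUnramifiedAt w ∧ ∃ a : Fin n → PadicAlgCl p', ρ'.HasFrobCharpolyAt w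
      (∏ i, (X - C (a i))) ∧ ∀ i j : Fin n, i ≠ j → ‖a i - a j‖ = 1 ∧ ‖a i - (l : PadicAlgCl p') * a
      j‖ = 1))
  · obtain ⟨p', hp', ι', ρ', hss', hsat', hv', hrange'⟩ := hfull
    obtain ⟨W', hW', hgen'⟩ := hOG hOcc K hK n hcpt π hπ p' ι' ρ' hss' hsat' hrange' v hv'
    obtain ⟨W, hW, hgen⟩ := h₁ K hK n hcpt π hπ p ι ρ hss hsat p' ι' ρ' hss' hsat' hrange' v hv hv'
      ⟨W', hW', hgen'⟩
    exact ⟨W, hW, hgen⟩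
  · obtain ⟨W, hW, hgen⟩ := h₂ K hK n hcpt π hπ p ι ρ hss hsat v hv (by
      intro p' hp' ι' ρ' hss' hsat' hv' hrange'
      exact hfull ⟨p', hp', ι', ρ', hss', hsat', hv', hrange'⟩)
    exact ⟨W, hW, hgen⟩

/-- … and hence OFFBOX from the UNRESTRICTED parent stubs too (through T, or directly through the restrictions). [folklore] -/
theorem offbox_of_parent_seam (hOcc : Summit.Langlands.Langlands.Theses.ParahoricFibre.ParahoricOccurrence) (hOG : Summit.Langlands.Langlands.Theses.ParahoricFibre.OccurrenceToGeneric)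
    (h₁ : GenericityPrimeSwitch) (h₂ : SmallMonodromyGeneric) : OffOrdinaryBoxGenericMonodromy :=
  offbox_of_seam hOcc hOG (offBoxPrimeSwitch_of h₁) (offBoxSmallMonodromy_of h₂)

end OffBoxSeam

/-! ## BC5 rungs of the deciding cell ORDBOX (texts only; the plan-only stubs live in the birth file) -/

/-- rung A text: ORDBOX ∣ `n = 2` (PRINT for the box by Matsumoto Thm 5.22 with `n = 2`; regime: CM `K`, FIXED `p ≥ 5`, where
`Langlands ∣ n = 2` over CM fields is open). -/
def OrdinaryBoxRankTwoRung : Prop :=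
  open IsDedekindDomain NumberField Polynomial Filter Literature.NumberTheory.Automorphic Literature.NumberTheory.GaloisRepresentations in ∀ (K : Type) [Field K] [NumberField K], NumberField.IsCMField K → ∀ (n : ℕ) (hcpt : isCompact_glFiniteIntegralLevel n K) (π : CuspidalAutomorphicRepData n K hcpt), π.1.IsRegularAlgebraic → ∀ (p : ℕ) [Fact p.Prime] (ι : PadicAlgCl p ≃+* ℂ) (ρ : FramedGaloisRep K (PadicAlgCl p) n), ρ.toGaloisRep.IsSemisimple → (∀ᶠ v : HeightOneSpectrum (𝓞 K) in cofinite, ∀ α : Multiset ℂ, π.1.HasSatakeParamAt v α → ρ.IsUnramifiedAt v ∧ ρ.HasFrobCharpolyAt v (arithFrobPolyOfSatake ι v.residueCard n α)) → ¬ (n ^ 2 < p ∧ ¬ ((p : ℤ) ∣ NumberField.discr K) ∧ (∀ w : HeightOneSpectrum (𝓞 K), ((p : ℕ) : 𝓞 K) ∈ w.asIdeal → π.1.IsUnramifiedAt w) ∧ (∃ g : GL (Fin n) (PadicAlgCl p), (∀ (σ : Field.absoluteGaloisGroup K) (i j : Fin n), ‖((g * ρ σ * g⁻¹ : GL (Fin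 n) (PadicAlgCl p)) : Matrix (Fin n) (Fin n) (PadicAlgCl p)) i j‖ ≤ 1) ∧ (∀ M : Matrix (Fin n) (Fin n) ℤ, M.det = 1 → ∃ σ : Field.absoluteGaloisGroup K, ∀ i j : Fin n, ‖((g * ρ σ * g⁻¹ : GL (Fin n) (PadicAlgCl p)) : Matrix (Fin n) (Fin n) (PadicAlgCl p)) i j - ((M i j : ℤ) : PadicAlgCl p)‖ < 1)) ∧ (∃ l : ℕ, l.Prime ∧ l ≠ p ∧ ∀ w : HeightOneSpectrum (𝓞 K), ((l : ℕ) : 𝓞 K) ∈ w.asIdeal → w.residueCard = l ∧ ρ.IsUnramifiedAt w ∧ ∃ a : Fin n → PadicAlgCl p, ρ.HasFrobCharpolyAt w (∏ i, (X - C (a i))) ∧ ∀ i j : Fin n, i ≠ j → ‖a i - a j‖ = 1 ∧ ‖a i - (l : PadicAlgCl p) * a j‖ = 1)) → (n ^ 2 < p ∧ (¬ ∃ ζ : K, IsPrimitiveRoot ζ p) ∧ (ρ.restrictField (CyclotomicField p K)).IsResiduallyAbsIrreducible ∧ (∃ l : ℕ, l.Prime ∧ l ≠ p ∧ ¬ (p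 ∣ (l - 1)) ∧ ¬ ((l : ℤ) ∣ NumberField.discr K) ∧ ∀ w : HeightOneSpectrum (𝓞 K), ((l : ℕ) : 𝓞 K) ∈ w.asIdeal → w.residueCard = l ∧ ρ.IsUnramifiedAt w ∧ ∃ a : Fin n → PadicAlgCl p, ρ.HasFrobCharpolyAt w (∏ i, (X - C (a i))) ∧ ∀ i j : Fin n, i ≠ j → ‖a i - (l : PadicAlgCl p) * a j‖ = 1) ∧ (∀ w : HeightOneSpectrum (𝓞 K), ((p : ℕ) : 𝓞 K) ∈ w.asIdeal → ∀ art : LocalArtinData (w.adicCompletion K), art.IsCanonical → ρ.IsOrdinaryRegularAt w art)) → n = 2 → ∀ v : HeightOneSpectrum (𝓞 K), ((p : ℕ) : 𝓞 K) ∉ v.asIdeal → ∃ W : WeilDeligneRep (v.adicCompletion K) (PadicAlgCl p) (Fin n → PadicAlgCl p), IsWeilDeligneOfLadic (ρ.toLocal v).toWeilGroupHom W ∧ ∀ f : (Fin n → PadicAlgCl p) →ₗ[PadicAlgCl p] (Fin n → PadicAlgCl p), (∀ w : WeilGroup (v.adicCompletion K), f ∘ₗ W.ρ w = ((IsNonarchimedeanLocalField.residueFieldCard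 (v.adicCompletion K) : PadicAlgCl p) ^ (WeilGroup.deg w)) • (W.ρ w ∘ₗ f)) → f ∘ₗ W.N = W.N ∘ₗ f → f = 0

/-- rung B text (KNOWN floor): ORDBOX ∣ «`v` an unramified Satake place of `(π, ρ)`» (`N = 0`; genericity = `α_i ≠ q·α_j`, i.e.
irreducibility of the unitary generic unramified `π_v` — Bernstein–Zelevinsky; inside the target's known regime). -/
def OrdinaryBoxUnramifiedPlaceRung : Prop :=
  open IsDedekindDomain NumberField Polynomial Filter Literature.NumberTheory.Automorphic Literature.NumberTheory.GaloisRepresentations in ∀ (K : Type) [Field K] [NumberField K], NumberField.IsCMField K → ∀ (n : ℕ) (hcpt : isCompact_glFiniteIntegralLevel n K) (π : CuspidalAutomorphicRepData n K hcpt), π.1.IsRegularAlgebraic → ∀ (p : ℕ) [Fact p.Prime] (ι : PadicAlgCl p ≃+* ℂ) (ρ : FramedGaloisRep K (PadicAlgCl p) n), ρ.toGaloisRep.IsSemisimple → (∀ᶠ v : HeightOneSpectrum (𝓞 K) in cofinite, ∀ α : Multiset ℂ, π.1.HasSatakeParamAt v α → ρ.IsUnramifiedAt v ∧ ρ.HasFrobCharpolyAt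 v (arithFrobPolyOfSatake ι v.residueCard n α)) → ¬ (n ^ 2 < p ∧ ¬ ((p : ℤ) ∣ NumberField.discr K) ∧ (∀ w : HeightOneSpectrum (𝓞 K), ((p : ℕ) : 𝓞 K) ∈ w.asIdeal → π.1.IsUnramifiedAt w) ∧ (∃ g : GL (Fin n) (PadicAlgCl p), (∀ (σ : Field.absoluteGaloisGroup K) (i j : Fin n), ‖((g * ρ σ * g⁻¹ : GL (Fin n) (PadicAlgCl p)) : Matrix (Fin n) (Fin n) (PadicAlgCl p)) i j‖ ≤ 1) ∧ (∀ M : Matrix (Fin n) (Fin n) ℤ, M.det = 1 → ∃ σ : Field.absoluteGaloisGroup K, ∀ i j : Fin n, ‖((g * ρ σ * g⁻¹ : GL (Fin n) (PadicAlgCl p)) : Matrix (Fin n) (Fin n) (PadicAlgCl p)) i j - ((M i j : ℤ) : PadicAlgCl p)‖ < 1)) ∧ (∃ l : ℕ, l.Prime ∧ l ≠ p ∧ ∀ w : HeightOneSpectrum (𝓞 K), ((l : ℕ) : 𝓞 K) ∈ w.asIdeal → w.residueCard = l ∧ ρ.IsUnramifiedAt w ∧ ∃ a : Fin n → PadicAlgCl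 p, ρ.HasFrobCharpolyAt w (∏ i, (X - C (a i))) ∧ ∀ i j : Fin n, i ≠ j → ‖a i - a j‖ = 1 ∧ ‖a i - (l : PadicAlgCl p) * a j‖ = 1)) → (n ^ 2 < p ∧ (¬ ∃ ζ : K, IsPrimitiveRoot ζ p) ∧ (ρ.restrictField (CyclotomicField p K)).IsResiduallyAbsIrreducible ∧ (∃ l : ℕ, l.Prime ∧ l ≠ p ∧ ¬ (p ∣ (l - 1)) ∧ ¬ ((l : ℤ) ∣ NumberField.discr K) ∧ ∀ w : HeightOneSpectrum (𝓞 K), ((l : ℕ) : 𝓞 K) ∈ w.asIdeal → w.residueCard = l ∧ ρ.IsUnramifiedAt w ∧ ∃ a : Fin n → PadicAlgCl p, ρ.HasFrobCharpolyAt w (∏ i, (X - C (a i))) ∧ ∀ i j : Fin n, i ≠ j → ‖a i - (l : PadicAlgCl p) * a j‖ = 1) ∧ (∀ w : HeightOneSpectrum (𝓞 K), ((p : ℕ) : 𝓞 K) ∈ w.asIdeal → ∀ art : LocalArtinData (w.adicCompletion K), art.IsCanonical → ρ.IsOrdinaryRegularAt w art)) → ∀ v : HeightOneSpectrum (𝓞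 K), ((p : ℕ) : 𝓞 K) ∉ v.asIdeal → (∃ α : Multiset ℂ, π.1.HasSatakeParamAt v α) → ρ.IsUnramifiedAt v → ∃ W : WeilDeligneRep (v.adicCompletion K) (PadicAlgCl p) (Fin n → PadicAlgCl p), IsWeilDeligneOfLadic (ρ.toLocal v).toWeilGroupHom W ∧ ∀ f : (Fin n → PadicAlgCl p) →ₗ[PadicAlgCl p] (Fin n → PadicAlgCl p), (∀ w : WeilGroup (v.adicCompletion K), f ∘ₗ W.ρ w = ((IsNonarchimedeanLocalField.residueFieldCard (v.adicCompletion K) : PadicAlgCl p) ^ (WeilGroup.deg w)) • (W.ρ w ∘ₗ f)) → f ∘ₗ W.N = W.N ∘ₗ f → f = 0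

/-- rung A IS the `n = 2` restriction of the cell. [folklore] -/
theorem rungA_of_ordbox (h : OrdinaryBoxGenericMonodromy) : OrdinaryBoxRankTwoRung :=
  fun K _ _ hK n hcpt π hπ p _ ι ρ hss hsat hoff hMB _ => h K hK n hcpt π hπ p ι ρ hss hsat hoff hMB

/-- rung B IS the unramified-place restriction of the cell. [folklore] -/
theorem rungB_of_ordbox (h : OrdinaryBoxGenericMonodromy) : OrdinaryBoxUnramifiedPlaceRung :=
  fun K _ _ hK n hcpt π hπ p _ ι ρ hss hsat hoff hMB v hv _ _ => h K hK n hcpt π hπ p ι ρ hss hsat hoff hMB v hv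

end Summit.Langlands.Langlands.Theorems.SmallRangeOrdinaryCarving
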